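import Summits.ABC.StewartYu.PadicG3ParNB
import Summits.ABC.StewartYu.RecordByNameV
import HarnessLib

/-!
# The `𝔑`-threaded `p`-adic Gen-3 record `PadicG3ParN` — the level-0 order in v2's shape and (B1) at the natural order

Support file (theorems only; no named facts). Cell `abc-stewartyu`, route `YuMatveevShapeRat`, crux `PadicCoreOddRat`
(stmt-ABC-20503); seat p1 (record owner). For p2's pack twin (`recordSupplyAtSatR_of_ineq`, R28(d)): the START order
bound of the `N`-frame in EXACTLY the v2 shape, so that `siegel_countN` is consumed as `siegel_countV'` was:

* `SdN_sub_SdG_le` — the extra depth `ŜN − ŜG ≤ ⌊log₂ N⌋ + 1 ≤ N ≤ (2/log 2)ⁿ·Ω` is absorbed by the v2 slack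
  (`24·C_bⁿ·Ω ≤ LgV` under `gⁿ ≤ K`, and `(2/log 2)ⁿ ≤ C_bⁿ`);
* **`MordN_T0_le'`** — `MordN 0 0 + (n+1)(ŜN+1) + n ≤ (69/4)(n+1)·LgV` (same right-hand side as `MordV_T0_le`);
* **`siegel_countN'`** — (B1) over `𝔑` at the natural order bound `M′ ≤ MordN 0 0 + (n+1)(ŜN+1)`:
  `2·(2·XsV 0 + 1)·C(M′+n, n)·K ≤ (L₀N + 1)·N·∏ⱼ(2·sideV j)`.

## References
* [Nesterenko2003] Yu. V. Nesterenko, LNM 1819 (2003) — (3.25), Prop 3.9 (3.48).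
-/

noncomputable section

open Finset Real

namespace Summit.ABC.StewartYu

namespace PadicG3ParN

open PadicG3Par (Cb cM cG Cb_pos sixtyfour_le_Cb)

variable {n : ℕ} (P : PadicG3ParN n)

/-- `⌊log₂ N⌋ + 1 ≤ N`. [folklore] -/
theorem natlog_N_succ_le_N : Nat.log 2 P.N + 1 ≤ P.N :=
  Nat.succ_le_of_lt (Nat.log_lt_of_lt_pow' (by have := P.hN; omega) Nat.lt_two_pow_self)

/-- **`ŜN − ŜG ≤ (2/log 2)ⁿ·Ω`** (real form) under `N_q = K`. [folklore] -/
theorem SdN_sub_SdG_le (hNq : P.Nq = P.K) : (P.SdN : ℝ) - P.SdG ≤ (2 / Real.log 2) ^ n * P.Ω := by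
  have h1 : (P.SdN : ℝ) ≤ P.SdG + Nat.log 2 P.N + 1 := by exact_mod_cast P.SdN_le hNq
  have h2 : ((Nat.log 2 P.N + 1 : ℕ) : ℝ) ≤ P.N := by exact_mod_cast P.natlog_N_succ_le_N
  push_cast at h2
  have h3 := P.hNΩ
  linarith

/-- `(2/log 2)ⁿ·Ω ≤ C_bⁿ·Ω` (as `2/log 2 ≤ 3 ≤ C_b`). [folklore] -/
theorem twoDivLog_pow_mul_le : (2 / Real.log 2) ^ n * P.Ω ≤ Cb ^ n * P.Ω := by
  have hl : Real.log 2 > 0.6931471803 := Real.log_two_gt_d9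
  have h1 : (2 : ℝ) / Real.log 2 ≤ 3 := by
    rw [div_le_iff₀ (by linarith)]; linarith
  have h2 : (3 : ℝ) ≤ Cb := by linarith [sixtyfour_le_Cb]
  have h0 : (0 : ℝ) ≤ 2 / Real.log 2 := by positivity
  have h3 : (2 / Real.log 2) ^ n ≤ Cb ^ n := pow_le_pow_left₀ h0 (h1.trans h2) n
  exact mul_le_mul_of_nonneg_right h3 P.Ω_pos.le

/-- **The level-0 order of the `N`-frame in v2's shape**: `MordN 0 0 + (n+1)(ŜN+1) + n ≤ (69/4)(n+1)·LgV` under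
`N_q = K` and `gⁿ ≤ K` (the extra `2(n+1)(ŜN − ŜG) ≤ 2(n+1)·C_bⁿ·Ω ≤ (n+1)·LgV/12` fits in v2's slack).
[cite: Nesterenko2003, (3.25)] -/
theorem MordN_T0_le' (hNq : P.Nq = P.K) (hgK : P.g ^ n ≤ (P.K : ℝ)) :
    (P.MordN 0 0 : ℝ) + (n + 1) * (P.SdN + 1) + n ≤ (69 / 4) * (n + 1) * P.LgV := by
  have h1 : ((P.MordN 0 0 : ℕ) : ℝ) ≤ ((P.MV / (n + 2) ^ 3 + (n + 1) * (16 * P.LgV + (P.SdN + 1)) : ℕ) : ℝ) := by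
    exact_mod_cast P.MordN_zero_zero_le
  have h2 : ((P.MV / (n + 2) ^ 3 : ℕ) : ℝ) ≤ (P.MV : ℝ) / 27 := by
    have h3 : P.MV / (n + 2) ^ 3 ≤ P.MV / 27 :=
      Nat.div_le_div_left (le_trans (by norm_num) (Nat.pow_le_pow_left (show 3 ≤ n + 2 by have := P.hn; omega) 3))
        (by norm_num)
    calc ((P.MV / (n + 2) ^ 3 : ℕ) : ℝ) ≤ ((P.MV / 27 : ℕ) : ℝ) := by exact_mod_cast h3
      _ ≤ (P.MV : ℝ) / 27 := Nat.cast_div_le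
  push_cast at h1
  rw [P.MV_real] at h2
  have h4 : ((4 * (P.SdG + 2) : ℕ) : ℝ) ≤ P.LgV := by exact_mod_cast P.four_SdG_le_LgV
  push_cast at h4
  have hS := P.SdN_sub_SdG_le hNq
  have hC := P.twoDivLog_pow_mul_le
  have h24 := P.core_Ω_le_LgV hgK
  have hn : (0 : ℝ) ≤ n := by positivity
  have hL : (2 : ℝ) ^ 25 ≤ P.LgV := by
    have := P.two_pow_le_LgV
    have h' : (2:ℕ) ^ 25 ≤ 2 ^ (n + 25) := Nat.pow_le_pow_right (by norm_num) (by omega)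
    exact_mod_cast h'.trans this
  have hn1 : (n : ℝ) ≤ (n + 1) * P.LgV / 2 ^ 25 := by
    rw [le_div_iff₀ (by positivity)]; nlinarith
  -- the extra depth: `(n+1)·2·(ŜN − ŜG) ≤ (n+1)·2·Cbⁿ Ω ≤ (n+1)·LgV/12`
  have hextra : 2 * ((P.SdN : ℝ) - P.SdG) ≤ P.LgV / 12 := by linarith
  nlinarith [mul_le_mul_of_nonneg_left hextra (by linarith : (0:ℝ) ≤ (n:ℝ) + 1)]

/-- **(B1) over `𝔑` at the natural order bound** `M′ ≤ MordN 0 0 + (n+1)(ŜN+1)`, under `N_q = K` and `gⁿ ≤ K`: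
`2·(2·XsV 0 + 1)·C(M′+n, n)·K ≤ (L₀N + 1)·N·∏ⱼ(2·sideV j)`. [cite: Nesterenko2003, Prop 3.9 (3.48)] -/
theorem siegel_countN' (hNq : P.Nq = P.K) (hgK : P.g ^ n ≤ (P.K : ℝ)) {M' : ℕ}
    (hM : M' ≤ P.MordN 0 0 + (n + 1) * (P.SdN + 1)) :
    2 * (2 * P.XsV 0 + 1) * Nat.choose (M' + n) n * P.K ≤ (P.L0N + 1) * P.N * ∏ j, (2 * P.sideV j) := by
  refine P.siegel_countN hgK ?_
  have h1 : (M' : ℝ) ≤ P.MordN 0 0 + (n + 1) * (P.SdN + 1) := by exact_mod_cast hM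
  have h2 := P.MordN_T0_le' hNq hgK
  have hn : (0 : ℝ) ≤ n := by positivity
  linarith

end PadicG3ParN

end Summit.ABC.StewartYu
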